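import Summits.CriticalPhenomena.PercolationContinuityZ3.Theorems.PercNearOneGluingNoHeavyQuantLightTwoBlobFlow
import HarnessLib

/-!
# QUANT lane R8, T-DEC: the BAND PIECE of Conjecture SL-λ* (census-1 g19, SLAMSTAR-G19 §2) — the typed statement `LawDec.BandTwoBlobDEC`
# and its reduction to two numerical facts (the flow: band copy into the shallow low's lifted copy, the rest into the giant)

builds on p205010 (kernel theorem, internal audit signed; external expert review pending)

Statement + support file (`--supports stmt-CriticalPhenomena-4575`), QUANT lane typer seat prim-quant-stmt (gen 24), rung R8 of
`run/shared/lean/prim/quant/LADDER.md`.  One `@[conjecture]` `Prop` (`LawDec.BandTwoBlobDEC`) and one theorem (standard axioms, no sorries).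
Companion of `…QuantSliceLightBelow` (typer g22: `LawDec.LightTwoBlobDEC`, discharged by typer g23 in `…QuantLightTwoBlobDEC`) and of
`…QuantLightTwoBlobFlow` (`twoBlob_decAtT_of_lowFlow`, whose bookkeeping this file mirrors).

WHY (README V264, LEAD-NOTES-G23 N50 (4)/(5), census-1 g19 SLAMSTAR-G19 §2).  After the corner identity (`cornerMidFlow_restrict`, lead g23) and the
sub-flow split (`…QuantFlowSplit`), the law-level programme for SL-λ* removes from `ν` every component `{l, h; γ_min}` of the canonical flow into a
column `h ≤ λ*` and slices it LOCALLY: below (`h + a ≤ j′`: `lightTwoBlobDEC_holds`), heavy (`HValidAt`), far (`slice_farPair_decAtT`), and the one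
case the lane believed to need pooling across pieces — a light NEAR pair `{l, w}` into a BAND-LIKE column (`T ≤ 2w ≤ T′ = T + ag`,
`w + a > j′ ≥ l + a`).  Census-1 g19: that piece is DEC(T′, j′) ON ITS OWN FOUR POSITIONS `{l, w, l+a, w+a}` (exact: grid 40 014 / 0, random
37 175 / 0, two engines 270 626 / 0); translated by `l` and written as a two-blob law it is the statement below.  With it every corner component
into a column `≤ λ*` is locally sliceable and the remainder is a pure window law (Theorem A / A⁺ / B world).

* **`LawDec.BandTwoBlobDEC`** (`@[conjecture]`, typed here): for `0 < x < 1`, `x² < γ < x ≤ g ≤ 1`, `a, b ≥ 1`, `ρ = (γ − x²)/(1 − x)` and the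
  BAND condition `b(2 − ρ) ≤ a·g` (⟺ `2b ≤ T″ := bρ + ag`: the light blob is band-like at the raised target), the law `LAW2[b, γ; a, g]` of
  `b·Bern(γ) + a·Bern(g)` is `DECAtT x (bρ + ag) j″ (b + a)` for EVERY layer `j″ ≥ a` — the straddling layers `a ≤ j″ < a + b` (top atom a
  giant) are the new content; `j″ ≥ a + b` is `LawDec.LightTwoBlobDEC` (kernel).  Without the band condition it is FALSE at straddling layers
  (census-1 g19: 259 / 3 586 true-mid partners fail).
* **`LawDec.twoBlob_decAtT_of_bandFlow`** — the flow for the straddling layers with the two numerical facts as hypotheses: law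
  `LAW2[b, γ; a, g]` (atoms `0, b, a, b+a`), `b < a ≤ j″ < b + a`, target `T` with `2b ≤ T ≤ 2a`, `T < a + b`; ship `b ↦ a` (amount `F₁`, only
  when `b` is low, `2b < T`), `0 ↦ a` (amount `F₂`, only when `T < a`), the rest of both low atoms into the GIANT `b + a` at rate `x/(1−x)`;
  if the mid `a` is not overloaded (`usage(b,a)·F₁ + usage(0,a)·F₂ ≤ (1−γ)g`) and the giant is not overloaded
  (`x/(1−x)·([2b < T]·(γ(1−g) − F₁) + (1−γ)(1−g) − F₂) ≤ γg`) then `DECAtT x T j″ (b + a) LAW2[b, γ; a, g]` (via `decAtT_of_flowAtT`).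
The numerical facts (corner strategy: `b` first, to capacity; then `0`; three non-trivial cells × light/heavy status of the pair `(b, a)` —
the pair `(0, a)` is always heavy since `T″/a ≥ g ≥ x`) are discharged in the companion files `…QuantBandTwoBlobPoly*` / `…Cells` /
`…QuantBandTwoBlobDEC` by exact polynomial certificates.  Second implementation of census-1's exact check: seat folder explore/band_piece.py
(grid 32 466 / 0, random 4 100 / 0 with real size ratio).

[this work]; DEC rules ARCH-TREES-G49 §2.2 / DEC-TAMP-G50 §3.1, flow normal form `…QuantLawDecFlows` (this lane).  Nothing here is cited as a
published result.  The gluing rows served [cite: KozmaNitzan2024, Conjecture 3 (p. 15)]; product measure [cite: Grimmett1999, §1.3 p. 10].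
-/

noncomputable section

namespace Summit.CriticalPhenomena.PercolationContinuityZ3.Theorems

namespace Quant

open Finset

/-- the two-blob law `(1−u)(1−v)δ₀ + u(1−v)δ_a + (1−u)vδ_b + uvδ_{a+b}` evaluated at `h` (as in `…QuantBlobDecTwoLawParts`) -/
local notation3 "LAW2[" a ", " u ", " b ", " v ", " h "]" =>
  (1 - (u : ℝ)) * (1 - (v : ℝ)) * (if (h : ℕ) = 0 then (1 : ℝ) else 0)
    + (u : ℝ) * (1 - (v : ℝ)) * (if (h : ℕ) = (a : ℕ) then (1 : ℝ) else 0)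
    + (1 - (u : ℝ)) * (v : ℝ) * (if (h : ℕ) = (b : ℕ) then (1 : ℝ) else 0)
    + (u : ℝ) * (v : ℝ) * (if (h : ℕ) = (a : ℕ) + (b : ℕ) then (1 : ℝ) else 0)

namespace LawDec

/-! ### The typed statement -/

/-- **CONJECTURE BAND-TWO-BLOB-DEC (the band piece of SL-λ*; census-1 g19, SLAMSTAR-G19 §2 (a), two-blob form).**  For a floor
`0 < x < 1`, a LIGHT gate `x² < γ < x`, a heavy gate `x ≤ g ≤ 1`, sizes `a, b ≥ 1`, the credit rate `ρ = (γ − x²)/(1 − x)` of the light blob,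
and the BAND condition `b·(2 − ρ) ≤ a·g` (the light blob atom `b` is not a true mid at the raised target `T″ = bρ + ag`: `2b ≤ T″`): for every
layer `j″ ≥ a` the law of `b·Bern(γ) + a·Bern(g)` — atoms `0, b, a, b+a` with masses `(1−γ)(1−g), γ(1−g), (1−γ)g, γg` — is DEC(j″) at the
target `bρ + ag` on `{0..b+a}`.  For `j″ ≥ a + b` this is `LawDec.LightTwoBlobDEC` (kernel, `lightTwoBlobDEC_holds`); the content is the
straddling range `a ≤ j″ < a + b`, where the top atom is a giant.  EVIDENCE (exact; the decision procedure is the kernel's corner run,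
`decAtT_iff_cornerSucceeds`): census-1 g19 grid 40 014 / 0, random 37 175 / 0, in situ 1 420 / 0, corner-vs-LP two engines 270 626 / 0
(prim-quant-census-1/SLAMSTAR-G19.md §2 (c)); typer g24 second implementation grid 32 466 / 0, random 4 100 / 0 (real size ratio).  WITNESS: the
corner run — `b ↦ a` at the gate from `ρ₁ = (T″ − 2b)/(a − b)`, then `0 ↦ a` at the (heavy) gate `T″/a` when `T″ < a`, leftovers into the giant
`a + b` at `x`; margin infimum `0` (relative slack `1.1·10⁻³` at `x = 23/24`).  WHY IT MATTERS: with it, every component of the canonical flow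
into a column `≤ λ*` is locally sliceable (README V264 step 3 made local). [this work] [status: open] -/
@[conjecture] def BandTwoBlobDEC : Prop :=
  ∀ (x γ g : ℝ) (a b j'' : ℕ), 0 < x → x < 1 → x ^ 2 < γ → γ < x → x ≤ g → g ≤ 1 → 1 ≤ a → 1 ≤ b → a ≤ j'' →
    (b : ℝ) * (2 - (γ - x ^ 2) / (1 - x)) ≤ (a : ℝ) * g →
    DECAtT x ((b : ℝ) * ((γ - x ^ 2) / (1 - x)) + (a : ℝ) * g) j'' (b + a) (fun h => LAW2[b, γ, a, g, h])

/-! ### The flow of the straddling layers -/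

/-- **DEC OF THE TWO-BLOB LAW AT A STRADDLING LAYER FROM THE BAND FLOW.**  Law `LAW2[b, γ; a, g]` (atoms `0, b, a, b+a`), floor
`0 < x < 1`, gates `γ, g ∈ [0,1]`, `1 ≤ b < a ≤ j″ < b + a` (the mid `a` below the layer, the top `b + a` a GIANT), target `T` with
`2b ≤ T ≤ 2a` and `T < a + b` (atom `0` low; `b` low iff `2b < T`, else self-sufficient; `a` a self-sufficient mid compatible with `b`).
Flow: `b ↦ a` (amount `F₁ ∈ [0, γ(1−g)]`, positive only if `2b < T`), `0 ↦ a` (amount `F₂ ∈ [0, (1−γ)(1−g)]`, positive only if `T < a`),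
the rest of the low atoms into the giant `b + a`.  If the mid is not overloaded, `usage(b,a)·F₁ + usage(0,a)·F₂ ≤ (1−γ)g`, and the giant
is not overloaded, `x/(1−x)·([2b<T]·(γ(1−g) − F₁) + ((1−γ)(1−g) − F₂)) ≤ γg`, then `DECAtT x T j″ (b + a) LAW2[b, γ; a, g]`. [this work] -/
theorem twoBlob_decAtT_of_bandFlow (x γ g T F₁ F₂ : ℝ) (a b j'' : ℕ) (hx0 : 0 < x) (hx1 : x < 1) (hγ0 : 0 ≤ γ) (hγ1 : γ ≤ 1)
    (hg0 : 0 ≤ g) (hg1 : g ≤ 1) (hb : 1 ≤ b) (hba : b < a) (hja : a ≤ j'') (hj : j'' < b + a)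
    (h2b : 2 * (b : ℝ) ≤ T) (hT2a : T ≤ 2 * (a : ℝ)) (hTab : T < (a : ℝ) + b)
    (hF1 : 0 ≤ F₁) (hF1' : F₁ ≤ γ * (1 - g)) (hF1c : 0 < F₁ → 2 * (b : ℝ) < T)
    (hF2 : 0 ≤ F₂) (hF2' : F₂ ≤ (1 - γ) * (1 - g)) (hF2c : 0 < F₂ → T < (a : ℝ))
    (hmid : usage x T j'' b a * F₁ + usage x T j'' 0 a * F₂ ≤ (1 - γ) * g)
    (htop : x / (1 - x) * ((if 2 * (b : ℝ) < T then γ * (1 - g) - F₁ else 0) + ((1 - γ) * (1 - g) - F₂)) ≤ γ * g) :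
    DECAtT x T j'' (b + a) (fun h => LAW2[b, γ, a, g, h]) := by
  classical
  have hb' : (1 : ℝ) ≤ b := by exact_mod_cast hb
  have hT0 : 0 < T := by linarith
  have hba' : (b : ℝ) < a := by exact_mod_cast hba
  have hmb : 0 ≤ γ * (1 - g) := mul_nonneg hγ0 (by linarith)
  -- the two leftovers
  set R₁ : ℝ := (if 2 * (b : ℝ) < T then γ * (1 - g) - F₁ else 0) with hR₁
  set R₂ : ℝ := (1 - γ) * (1 - g) - F₂ with hR₂
  have hR₁0 : 0 ≤ R₁ := by rw [hR₁]; split_ifs <;> linarith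
  have hR₂0 : 0 ≤ R₂ := by rw [hR₂]; linarith
  set f : ℕ → ℕ → ℝ := fun l h =>
    F₁ * (if l = b then (1:ℝ) else 0) * (if h = a then (1:ℝ) else 0)
      + R₁ * (if l = b then (1:ℝ) else 0) * (if h = b + a then (1:ℝ) else 0)
      + F₂ * (if l = 0 then (1:ℝ) else 0) * (if h = a then (1:ℝ) else 0)
      + R₂ * (if l = 0 then (1:ℝ) else 0) * (if h = b + a then (1:ℝ) else 0) with hf
  have ind_nn : ∀ (P : Prop) [Decidable P], (0:ℝ) ≤ (if P then (1:ℝ) else 0) := fun P _ => by split_ifs <;> norm_num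
  refine decAtT_of_flowAtT x T j'' (b + a) _ hx0 hx1 (fun h hh => BlobDec2.law_eq_zero_of_lt b a γ g h hh)
    (BlobDec2.law_mass b a γ g) ⟨f, ?_, ?_, ?_, ?_⟩
  · -- nonnegativity
    intro l h
    simp only [hf]
    have i1 := ind_nn (l = b); have i2 := ind_nn (h = a); have i3 := ind_nn (l = 0); have i4 := ind_nn (h = b + a)
    have := mul_nonneg (mul_nonneg hF1 i1) i2
    have := mul_nonneg (mul_nonneg hR₁0 i1) i4
    have := mul_nonneg (mul_nonneg hF2 i3) i2
    have := mul_nonneg (mul_nonneg hR₂0 i3) i4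
    linarith
  · -- support: used pairs are (b, a) [only if F₁ > 0], (b, b+a) [only if b is low], (0, a) [only if F₂ > 0], (0, b+a)
    intro l h hpos
    simp only [hf] at hpos
    by_cases hl : l = b
    · rw [if_pos hl, if_neg (show l ≠ 0 by omega)] at hpos
      simp only [mul_one, mul_zero, zero_mul, add_zero] at hpos
      by_cases hh : h = a
      · rw [if_pos hh, if_neg (show h ≠ b + a by omega), mul_one, mul_zero, add_zero] at hpos
        refine ⟨by omega, by rw [hl]; exact hF1c hpos, by omega, Or.inr ?_⟩
        rw [hl, hh]; linarith
      · rw [if_neg hh, mul_zero, zero_add] at hpos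
        by_cases hh' : h = b + a
        · rw [if_pos hh', mul_one] at hpos
          have hlow : 2 * (b : ℝ) < T := by
            by_contra hn; rw [hR₁, if_neg hn] at hpos; exact lt_irrefl _ hpos
          exact ⟨by omega, by rw [hl]; exact hlow, by omega, Or.inl (by omega)⟩
        · rw [if_neg hh', mul_zero] at hpos; exact absurd hpos (lt_irrefl 0)
    · rw [if_neg hl] at hpos
      by_cases hl0 : l = 0
      · rw [if_pos hl0] at hpos
        simp only [mul_one, mul_zero, zero_mul, zero_add] at hpos
        by_cases hh : h = a
        · rw [if_pos hh, if_neg (show h ≠ b + a by omega), mul_one, mul_zero, add_zero] at hpos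
          refine ⟨by omega, by rw [hl0]; simpa using hT0, by omega, Or.inr ?_⟩
          rw [hl0, hh]; simpa using hF2c hpos
        · rw [if_neg hh, mul_zero, zero_add] at hpos
          by_cases hh' : h = b + a
          · exact ⟨by omega, by rw [hl0]; simpa using hT0, by omega, Or.inl (by omega)⟩
          · rw [if_neg hh', mul_zero] at hpos; exact absurd hpos (lt_irrefl 0)
      · rw [if_neg hl0] at hpos
        simp only [mul_zero, zero_mul, add_zero] at hpos
        exact absurd hpos (lt_irrefl 0)
  · -- every low atom is shipped exactly
    intro l hlj hlow
    have hsum : ∑ h ∈ Finset.range (b + a + 1), f l h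
        = F₁ * (if l = b then (1:ℝ) else 0) + R₁ * (if l = b then (1:ℝ) else 0)
          + F₂ * (if l = 0 then (1:ℝ) else 0) + R₂ * (if l = 0 then (1:ℝ) else 0) := by
      simp only [hf, Finset.sum_add_distrib]
      rw [BlobDec2.sum_range_const_indicator _ a (by omega), BlobDec2.sum_range_const_indicator _ (b + a) le_rfl,
        BlobDec2.sum_range_const_indicator _ a (by omega), BlobDec2.sum_range_const_indicator _ (b + a) le_rfl]
    rw [hsum]
    dsimp only
    -- the low atoms among `l ≤ j″` with `2l < T`: `0`, and `b` when `2b < T` (not `a`; `b + a > j″`)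
    have hla : l ≠ a := by rintro rfl; linarith
    have hlba : l ≠ b + a := by omega
    by_cases hl0 : l = 0
    · have hlb : l ≠ b := by omega
      rw [if_neg hlb, if_pos hl0, if_neg hla, if_neg hlba, hR₂]
      ring
    · by_cases hlb : l = b
      · have hlowb : 2 * (b : ℝ) < T := by rw [← hlb]; exact hlow
        rw [if_pos hlb, if_neg hl0, if_neg hla, if_neg hlba, hR₁, if_pos hlowb]
        ring
      · rw [if_neg hlb, if_neg hl0, if_neg hla, if_neg hlba]
        ring
  · -- no absorber is overloaded
    intro h hhM hself
    have hsum : ∑ l ∈ Finset.range (j'' + 1), usage x T j'' l h * f l h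
        = usage x T j'' b h * F₁ * (if h = a then (1:ℝ) else 0)
          + usage x T j'' b h * R₁ * (if h = b + a then (1:ℝ) else 0)
          + usage x T j'' 0 h * F₂ * (if h = a then (1:ℝ) else 0)
          + usage x T j'' 0 h * R₂ * (if h = b + a then (1:ℝ) else 0) := by
      have e : ∀ l, usage x T j'' l h * f l h
          = (usage x T j'' b h * F₁ * (if h = a then (1:ℝ) else 0)) * (if l = b then (1:ℝ) else 0)
            + (usage x T j'' b h * R₁ * (if h = b + a then (1:ℝ) else 0)) * (if l = b then (1:ℝ) else 0)
            + (usage x T j'' 0 h * F₂ * (if h = a then (1:ℝ) else 0)) * (if l = 0 then (1:ℝ) else 0)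
            + (usage x T j'' 0 h * R₂ * (if h = b + a then (1:ℝ) else 0)) * (if l = 0 then (1:ℝ) else 0) := by
        intro l
        simp only [hf]
        by_cases hl : l = b
        · rw [if_pos hl, if_neg (show l ≠ 0 by omega), hl]; ring
        · by_cases hl0 : l = 0
          · rw [if_neg hl, if_pos hl0, hl0]; ring
          · rw [if_neg hl, if_neg hl0]; ring
      simp only [e, Finset.sum_add_distrib]
      rw [BlobDec2.sum_range_const_indicator _ b (by omega), BlobDec2.sum_range_const_indicator _ b (by omega),
        BlobDec2.sum_range_const_indicator _ 0 (Nat.zero_le _), BlobDec2.sum_range_const_indicator _ 0 (Nat.zero_le _)]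
    rw [hsum]
    dsimp only
    have hh0 : h ≠ 0 := by
      rintro rfl
      rcases hself with h1 | h1
      · omega
      · simp at h1; linarith
    by_cases hha : h = a
    · -- the mid `a`
      have hnba : h ≠ b + a := by omega
      rw [if_pos hha, if_neg hnba, if_neg hh0, if_neg (show h ≠ b by omega)]
      have e : usage x T j'' b h * F₁ * 1 + usage x T j'' b h * R₁ * 0 + usage x T j'' 0 h * F₂ * 1 + usage x T j'' 0 h * R₂ * 0
          = usage x T j'' b a * F₁ + usage x T j'' 0 a * F₂ := by rw [hha]; ring
      rw [e]
      linarith [hmid]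
    · by_cases hhba : h = b + a
      · -- the giant `b + a`: usage `x/(1−x)` for both lows
        rw [if_pos hhba, if_neg hha, if_neg hh0, if_neg (show h ≠ b by omega)]
        have hgb : j'' + 1 ≤ h := by omega
        rw [usage_giant_eq x T j'' b h hgb, usage_giant_eq x T j'' 0 h hgb]
        have : x / (1 - x) * R₁ + x / (1 - x) * R₂ ≤ γ * g := by rw [← mul_add]; exact htop
        linarith
      · -- any other position (in particular `b` when it is self-sufficient) carries no load
        have hL := BlobDec2.law_nonneg b a γ g hγ0 hγ1 hg0 hg1 h
        rw [if_neg hha, if_neg hhba] at hL ⊢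
        have e0 : usage x T j'' b h * F₁ * 0 + usage x T j'' b h * R₁ * 0 + usage x T j'' 0 h * F₂ * 0
            + usage x T j'' 0 h * R₂ * 0 = 0 := by ring
        rw [e0]
        exact hL

end LawDec

end Quant

end Summit.CriticalPhenomena.PercolationContinuityZ3.Theorems
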